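import Summits.CriticalPhenomena.CardyFormulaZ2.Theorems.CardySusyWardWeakHolomorphyAliasSplit
import Summits.CriticalPhenomena.CardyFormulaZ2.Theorems.CardySusyWardWeakHolomorphyStaggeredFourDartFree

/-!
# The staggered pairing of the spin-`1/3` VERTEX observable is free

Line `Sketch` of the crux `CardySusyWard.WeakHolomorphy` (stmt-CriticalPhenomena-11292), lead c5 (`--supports`),
registered stub `stub_staggeredVertexPairingFree`.  The crux pairs the spin-`1/3` vertex observable
`F_δ(z) = ∫ passageSum (medialExploration (Λ δ) ω) δ (1/3) z dP_{1/2}` of the exploration path against `∂̄φ` at the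
scale `δ^{5/3}`.  Here its h/v-STAGGERED pairing `δ^{5/3} Σ_p ψ(z_p)·s_p·F_δ(z_p)` (`s_p = +1 / −1` at horizontal /
vertical medial vertices) is shown to tend to `0` as `δ → 0⁺` for EVERY smooth compactly supported weight `ψ` with
`tsupport ψ ⊆ Ω`, along every admissible family: horizontal and vertical medial vertices contribute equally at the crux
scale.  Two moves over landed files: (1) the every-spin four-dart split `fourDart_split_medialExploration_spin` at
`σ = 1/3` (constant `2cos(π/12) > 0`), integrated (`vertex_eq_sum_third`) and made eventual above the compact
`tsupport ψ ⊆ Ω`, which the two `A`–`B` edges leave eventually (`vertex_eq_sum_third_eventually`, the spin-`1/3` copy of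
`aliasVertex_eq_sum_eventually`): `2cos(π/12)·F_δ(z_p) = Σ_k bondDartObservable (Λ δ) δ (1/3) (c_{p,k})`; (2) the
staggered four-dart mode `δ^{5/3} Σ_p ψ(z_p)·s_p·Σ_k bondDartObservable (Λ δ) δ (1/3) (c_{p,k})` is free
(`stub_staggeredFourDartFree`), so the vertex pairing is eventually `(2cos(π/12))⁻¹` times a null sequence.
References: S. Smirnov, Ann. Math. 172 (2010) §2.2; Duminil-Copin–Smirnov arXiv:1109.1549 §8.3; crux workfile
`Cruxes/WeakHolomorphy/Disproof.lean §C`.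
-/

noncomputable section

namespace Summit.CriticalPhenomena.CardyFormulaZ2.Theorems.WeakHolomorphy.SplitBypass

open scoped BigOperators Topology
open Filter Set MeasureTheory Complex
open _root_.Literature.Probability.LatticeModels
open _root_.Literature.Probability.RandomPlanarGeometry (DobrushinDomain)
open _root_.Literature.Probability.Percolation (BondConfig bondPercolation half)
open _root_.Literature.Barriers.CriticalPhenomena (medialCornersAt medialVertexOf)
open Summit.CriticalPhenomena.CardyFormulaZ2.Theorems.ParafermionPrecompact.Negative (IsFamily)
open Summit.CriticalPhenomena.CardyFormulaZ2.Cruxes.ParafermionPrecompact.KenyonStreamSecondRelation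
  (mv pivotOf classOffset classComp integrable_dartPhaseSum)

/-! ## The split constant at spin `1/3` -/

/-- `2cos(π/12) > 0`: the four-dart split constant `2cos(σπ/4)` at the spin `σ = 1/3` is positive. [folklore] -/
theorem two_cos_third_pos : 0 < 2 * Real.cos (((1 : ℝ) / 3) * Real.pi / 4) := by
  have : 0 < Real.cos (((1 : ℝ) / 3) * Real.pi / 4) :=
    Real.cos_pos_of_mem_Ioo ⟨by linarith [Real.pi_pos], by linarith [Real.pi_pos]⟩
  linarith

/-! ## The spin-`1/3` vertex observable as a corner sum -/

/-- **The spin-`1/3` vertex observable as a corner sum, at one mesh**: for every datum `E`, mesh `δ > 0` and genuine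
medial vertex `p` which is not an `A`–`B` edge,
`2cos(π/12) · ∫ passageSum γ_ω δ (1/3) z_p = Σ_k bondDartObservable E δ (1/3) (c_{p,k})`
(the every-spin four-dart split at `σ = 1/3`, integrated term by term). [folklore] -/
theorem vertex_eq_sum_third (E : DiscreteDobrushin) {δ : ℝ} (hδ : 0 < δ) (p : Site 2 × Fin 2)
    (hz : medialVertexOf p ∉ E.zdABEdges) :
    ((2 * Real.cos (((1 : ℝ) / 3) * Real.pi / 4) : ℝ) : ℂ) *
        ∫ ω, MedialPath.passageSum (medialExploration E ω) δ (1 / 3) (medialVertexOf p)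
          ∂(bondPercolation (zdGraph 2) half) =
      ∑ k : Fin 4, bondDartObservable E δ (1 / 3) (medialCornersAt p.1 p.2 k) := by
  obtain ⟨x, i⟩ := p
  have hmv : medialVertexOf (x, i) = mv (x, i) := rfl
  have key : ∀ ω, ((2 * Real.cos (((1 : ℝ) / 3) * Real.pi / 4) : ℝ) : ℂ) *
      MedialPath.passageSum (medialExploration E ω) δ (1 / 3) (mv (x, i)) =
        ∑ k : Fin 4, Parafermion.dartPhaseSum (medialExploration E ω) δ (1 / 3) (medialCornersAt x i k) := by
    intro ω
    have h := fourDart_split_medialExploration_spin ((1 : ℝ) / 3) E hδ.ne' ω x i (hmv ▸ hz)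
    rw [show ((1 : ℝ) / 3) = (1 / 3 : ℝ) by norm_num] at h
    rw [h, ← sum_classComp_pivotOf (fun c => Parafermion.dartPhaseSum (medialExploration E ω) δ (1 / 3) c) x i]
    rfl
  rw [hmv, ← integral_const_mul]
  simp only [key]
  rw [integral_finsetSum _ fun k _ => integrable_dartPhaseSum E δ (1 / 3) _]
  simp only [Parafermion.bondDartObservable_def]

/-- **The spin-`1/3` vertex observable as a corner sum, eventually above a compact**: along an admissible family,
eventually in `δ`, at every genuine medial vertex above a compact `K ⊆ Ω`,
`2cos(π/12) · F_δ(z_p) = Σ_k bondDartObservable (Λ δ) δ (1/3) (c_{p,k})` (the two `A`–`B` edges converge in Hausdorff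
distance to the two marked boundary points, hence leave a closed thickening of `K` inside `Ω` eventually). [folklore] -/
theorem vertex_eq_sum_third_eventually (D : DobrushinDomain) (Λ : ℝ → DiscreteDobrushin) (hΛ : IsFamily D Λ)
    (K : Set ℂ) (hK : IsCompact K) (hKD : K ⊆ D.carrier) :
    ∀ᶠ δ in 𝓝[>] (0:ℝ), ∀ p : Site 2 × Fin 2, medialPoint δ (medialVertexOf p) ∈ K →
      ((2 * Real.cos (((1 : ℝ) / 3) * Real.pi / 4) : ℝ) : ℂ) *
          ∫ ω, MedialPath.passageSum (medialExploration (Λ δ) ω) δ (1 / 3) (medialVertexOf p)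
            ∂(bondPercolation (zdGraph 2) half) =
        ∑ k : Fin 4, bondDartObservable (Λ δ) δ (1 / 3) (medialCornersAt p.1 p.2 k) := by
  obtain ⟨-, -, -, -, hAB, -⟩ := hΛ
  obtain ⟨r, hr, hrK⟩ := hK.exists_cthickening_subset_open D.isOpen hKD
  have hev : ∀ᶠ δ in 𝓝[>] (0:ℝ), Metric.hausdorffEDist (medialPoint δ '' (Λ δ).zdABEdges)
      {D.pt 0, D.pt 1} < ENNReal.ofReal r :=
    hAB.eventually (gt_mem_nhds (ENNReal.ofReal_pos.2 hr))
  filter_upwards [hev, self_mem_nhdsWithin] with δ hδlt hδpos p hpK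
  refine vertex_eq_sum_third (Λ δ) hδpos p fun hz => ?_
  obtain ⟨y, hy, hdist⟩ :=
    Metric.exists_edist_lt_of_hausdorffEDist_lt (mem_image_of_mem _ hz) hδlt
  have hyf : y ∈ frontier D.carrier := by
    rcases hy with rfl | rfl <;> exact D.pt_mem_frontier _
  have hyD : y ∈ D.carrier := hrK (Metric.mem_cthickening_of_dist_le _ _ _ _ hpK
    (by rw [dist_comm]; exact (edist_lt_ofReal.1 hdist).le))
  exact hyf.2 (interior_maximal Subset.rfl D.isOpen hyD)

/-! ## The staggered vertex pairing is free -/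

/-- **`stub_staggeredVertexPairingFree` — the staggered pairing of the spin-`1/3` vertex observable is free.** For every
Dobrushin domain `D`, every admissible family `Λ` and every smooth compactly supported weight `ψ` with `tsupport ψ ⊆ Ω`,
`δ^{5/3} · Σ_p ψ(z_p) · s_p · F_δ(z_p) → 0` as `δ → 0⁺`, where
`F_δ(z) = ∫ passageSum (medialExploration (Λ δ) ω) δ (1/3) z dP_{1/2}` and `s_p = +1 / −1` at horizontal / vertical
medial vertices.  (Eventually, at every `p` with `ψ(z_p) ≠ 0`, `F_δ(z_p) = (2cos(π/12))⁻¹ Σ_k bondDartObservable (Λ δ) δ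
(1/3) (c_{p,k})` by `vertex_eq_sum_third_eventually` over `K = tsupport ψ`; so the pairing is `(2cos(π/12))⁻¹` times the
staggered four-dart pairing, which is null by `stub_staggeredFourDartFree`.) [folklore] -/
theorem stub_staggeredVertexPairingFree : ∀ (D : DobrushinDomain) (Λ : ℝ → DiscreteDobrushin), IsFamily D Λ → ∀ (ψ : ℂ → ℂ), ContDiff ℝ (⊤ : ℕ∞) ψ → HasCompactSupport ψ → tsupport ψ ⊆ D.carrier → Tendsto (fun δ : ℝ => ((δ ^ ((5:ℝ) / 3) : ℝ) : ℂ) * ∑ᶠ p : Site 2 × Fin 2, ψ (medialPoint δ (medialVertexOf p)) * ((if p.2 = 0 then (1 : ℂ) else -1) * ∫ ω, MedialPath.passageSum (medialExploration (Λ δ) ω) δ (1 / 3) (medialVertexOf p) ∂(bondPercolation (zdGraph 2) half))) (𝓝[>] 0) (𝓝 0) := by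
  intro D Λ hΛ ψ hψ hc hsupp
  have h4 := stub_staggeredFourDartFree Λ hΛ.2.2.2.2.2 ψ hψ hc
  have hev := vertex_eq_sum_third_eventually D Λ hΛ (tsupport ψ) hc.isCompact hsupp
  have hC : ((2 * Real.cos (((1 : ℝ) / 3) * Real.pi / 4) : ℝ) : ℂ) ≠ 0 := by
    exact_mod_cast two_cos_third_pos.ne'
  have hlim := h4.const_mul ((2 * Real.cos (((1 : ℝ) / 3) * Real.pi / 4) : ℝ) : ℂ)⁻¹
  rw [mul_zero] at hlim
  refine hlim.congr' ?_
  filter_upwards [hev] with δ hδ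
  rw [mul_left_comm, mul_finsum]
  congr 1
  refine finsum_congr fun p => ?_
  by_cases hψp : ψ (medialPoint δ (medialVertexOf p)) = 0
  · simp [hψp]
  · have hpK : medialPoint δ (medialVertexOf p) ∈ tsupport ψ := subset_tsupport ψ (Function.mem_support.2 hψp)
    rw [(eq_inv_mul_iff_mul_eq₀ hC).2 (hδ p hpK), Fin.sum_univ_four]
    ring

end Summit.CriticalPhenomena.CardyFormulaZ2.Theorems.WeakHolomorphy.SplitBypass

end
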